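import Mathlib
import Summits.CriticalPhenomena.CardyFormulaZ2.Theorems.CardyMagicRigidityNestingRigidityUVLinearisation
import HarnessLib

/-!
# Crux `NestingRigidity`, line `positive-cone-weight-doubling`: one cell and the generalised Hölder
# step of the multi-scale bound behind the untilted exponential moments of the UV statistic

Crux `Summit.CriticalPhenomena.CardyFormulaZ2.Theses.CardyMagicRigidity.NestingRigidity`
(stmt-CriticalPhenomena-4835), line `positive-cone-weight-doubling`, registered helper [A]
`uvExpMoments_latticeEnsembles` (all-order untilted exponential moments of the centred additive UV
statistic `Θ + t·E_δ N` of the cone cloud, both lattices).  The multi-scale proof of [A] writes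
`Θ − E Θ = Σ_k Z_k` (one centred statistic per dyadic scale `k`), each `Z_k = Σ_i (Y_{k,i} − E Y_{k,i})`
a sum over the cells of scale `k` of cell statistics that are INDEPENDENT inside each of `L`
chessboard classes and DOMINATED by a loop count with exponential moments, `|Y_{k,i}| ≤ b_k N_{k,i}`,
`b_k ≍ 4^{-k}` (a loop of diameter `≍ 2^{-k} r` bites at most `diam²/r²` of the disc).  This file
proves, on an arbitrary probability space (no lattice input, no cited fact, no definition):

* §1 calculus: `e^y − 1 − y ≤ y² e^{y}` and `y² e^{ay} ≤ 2 e^{(a+1)y}` for `y ≥ 0` (whence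
  `e^x − 1 − x ≤ x² e^{|x|}` for all real `x`, inside §2);
* §2 ONE CELL (registered anchor `expMoment_centred_le_latticeEnsembles` on `E.P`): if `|Y| ≤ b N`,
  `0 ≤ N`, `E e^{(A+1)N} ≤ K` and `|λ| b ≤ A`, then `E e^{λ(Y − EY)} ≤ exp(2 λ² b² K²)` — a centred
  bound QUADRATIC in `λ` (second-order expansion, `E[λ(Y − EY)] = 0`, Jensen `e^{(A+1)EN} ≤ K`), the
  shape that makes the dyadic scales summable (`Σ_k (s/w_k)² b_k² #cells_k · w_k < ∞`, `w_k = 2^{-k-1}`);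
* §3 GENERALISED HÖLDER for exponentials (registered anchor `expMoment_sum_le_prod_latticeEnsembles`):
  `E e^{Σ_i X_i} ≤ Π_i (E e^{X_i/w_i})^{w_i}` for positive weights of total mass `≤ 1` (Mathlib's
  `ENNReal.lintegral_prod_norm_pow_le`), the tool both for the `L` dependent chessboard classes of
  one scale and for the assembly across scales (…UVExpMomentsAssembly).
-/

noncomputable section

open MeasureTheory ProbabilityTheory Set Filter
open scoped Real Topology BigOperators ENNReal

namespace Summit.CriticalPhenomena.CardyFormulaZ2.Cruxes.NestingRigidity.PositiveConeWeightDoubling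

open Summit.CriticalPhenomena.CardyFormulaZ2.Cruxes.NestingRigidity.RingCloudTomography

namespace UVExpMoments

/-! ## §1 Calculus -/

/-- `e^y − 1 − y ≤ y² e^y` for `y ≥ 0` (twice `e^y − 1 ≤ y e^y`, i.e. `1 − y ≤ e^{−y}`). -/
theorem exp_sub_one_sub_le_sq_mul_exp {y : ℝ} (hy : 0 ≤ y) :
    Real.exp y - 1 - y ≤ y ^ 2 * Real.exp y := by
  have h1 : Real.exp y - 1 ≤ y * Real.exp y := by
    have h := Real.add_one_le_exp (-y)
    rw [Real.exp_neg] at h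
    have hpos := Real.exp_pos y
    have : (-y + 1) * Real.exp y ≤ 1 := by
      calc (-y + 1) * Real.exp y ≤ (Real.exp y)⁻¹ * Real.exp y :=
            mul_le_mul_of_nonneg_right h hpos.le
        _ = 1 := inv_mul_cancel₀ hpos.ne'
    nlinarith
  nlinarith [Real.exp_pos y, mul_le_mul_of_nonneg_left h1 hy]

/-- `y² e^{a y} ≤ 2 e^{(a+1) y}` for `y ≥ 0` (`1 + y + y²/2 ≤ e^y`, Mathlib's
`Real.quadratic_le_exp_of_nonneg`). -/
theorem sq_mul_exp_le {y a : ℝ} (hy : 0 ≤ y) :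
    y ^ 2 * Real.exp (a * y) ≤ 2 * Real.exp ((a + 1) * y) := by
  rw [show (a + 1) * y = a * y + y by ring, Real.exp_add]
  have h := Real.quadratic_le_exp_of_nonneg hy
  nlinarith [Real.exp_pos (a * y), Real.exp_pos y]

/-! ## §2 One cell: the centred exponential moment of a dominated statistic -/

variable {Ω : Type*} [MeasurableSpace Ω] {μ : Measure Ω}

/-- **Jensen for `exp`** on a probability space: `exp(E N) ≤ E e^N` for integrable `N`, `e^N`. -/
theorem exp_integral_le_integral_exp [IsProbabilityMeasure μ] {N : Ω → ℝ} (hN : Integrable N μ)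
    (heN : Integrable (fun ω ↦ Real.exp (N ω)) μ) :
    Real.exp (∫ ω, N ω ∂μ) ≤ ∫ ω, Real.exp (N ω) ∂μ :=
  convexOn_exp.map_integral_le Real.continuous_exp.continuousOn isClosed_univ
    (Eventually.of_forall fun _ ↦ mem_univ _) hN heN

/-- A nonnegative statistic with an exponential moment of order `c ≥ 1` is integrable, with
`E N ≤ E e^{cN}` and `exp(E N) ≤ E e^{cN}`… we record the two facts used below: integrability of `N`
and of `e^{N}`. -/
theorem integrable_of_exp_mul {N : Ω → ℝ} (hNm : Measurable N) (hN0 : ∀ ω, 0 ≤ N ω) {c : ℝ}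
    (hc : 1 ≤ c) (hK : Integrable (fun ω ↦ Real.exp (c * N ω)) μ) :
    Integrable N μ ∧ Integrable (fun ω ↦ Real.exp (N ω)) μ := by
  have h1 : ∀ ω, Real.exp (N ω) ≤ Real.exp (c * N ω) := fun ω ↦
    Real.exp_le_exp.2 (by nlinarith [hN0 ω])
  have heN : Integrable (fun ω ↦ Real.exp (N ω)) μ :=
    hK.mono' (Real.measurable_exp.comp hNm).aestronglyMeasurable
      (Eventually.of_forall fun ω ↦ by
        rw [Real.norm_eq_abs, abs_of_pos (Real.exp_pos _)]; exact h1 ω)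
  refine ⟨heN.mono' hNm.aestronglyMeasurable (Eventually.of_forall fun ω ↦ ?_), heN⟩
  rw [Real.norm_eq_abs, abs_of_nonneg (hN0 ω)]
  linarith [Real.add_one_le_exp (N ω)]

/-- **The centred exponential moment of a dominated statistic (one cell).**  On a probability
space, if `|Y| ≤ b N` pointwise with `N ≥ 0`, `E e^{(A+1)N} ≤ K` and `|λ| b ≤ A`, then
`e^{λ(Y − EY)}` is integrable and `E e^{λ(Y − EY)} ≤ exp(2 λ² b² K²)`.  Proof: with
`x = λ(Y − EY)`, `|x| ≤ |λ| b (N + EN)`, so `e^x ≤ 1 + x + x² e^{|x|} ≤ 1 + x + 2λ²b² e^{(A+1)(N + EN)}`;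
integrate (`E x = 0`) and use Jensen `e^{(A+1)EN} ≤ E e^{(A+1)N} ≤ K`. -/
theorem integral_exp_centred_le [IsProbabilityMeasure μ] {Y N : Ω → ℝ} {b A K l : ℝ}
    (hYm : Measurable Y) (hNm : Measurable N) (hb : 0 ≤ b) (hdom : ∀ ω, |Y ω| ≤ b * N ω)
    (hN0 : ∀ ω, 0 ≤ N ω) (hKi : Integrable (fun ω ↦ Real.exp ((A + 1) * N ω)) μ)
    (hK : ∫ ω, Real.exp ((A + 1) * N ω) ∂μ ≤ K) (hl : |l| * b ≤ A) :
    Integrable (fun ω ↦ Real.exp (l * (Y ω - ∫ ω', Y ω' ∂μ))) μ ∧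
      ∫ ω, Real.exp (l * (Y ω - ∫ ω', Y ω' ∂μ)) ∂μ ≤ Real.exp (2 * l ^ 2 * b ^ 2 * K ^ 2) := by
  have hA0 : 0 ≤ A := le_trans (mul_nonneg (abs_nonneg l) hb) hl
  have hA1 : (1 : ℝ) ≤ A + 1 := by linarith
  obtain ⟨hNi, -⟩ := integrable_of_exp_mul hNm hN0 hA1 hKi
  set m : ℝ := ∫ ω, N ω ∂μ with hm
  have hm0 : 0 ≤ m := integral_nonneg hN0
  -- `Y` is integrable and `|E Y| ≤ b m`
  have hYi : Integrable Y μ :=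
    (hNi.const_mul b).mono' hYm.aestronglyMeasurable
      (Eventually.of_forall fun ω ↦ by rw [Real.norm_eq_abs]; exact hdom ω)
  set mY : ℝ := ∫ ω, Y ω ∂μ with hmY
  have hmY_le : |mY| ≤ b * m := by
    calc |mY| ≤ ∫ ω, |Y ω| ∂μ := abs_integral_le_integral_abs
      _ ≤ ∫ ω, b * N ω ∂μ := integral_mono hYi.abs (hNi.const_mul b) hdom
      _ = b * m := integral_const_mul _ _
  -- Jensen at order `A + 1`
  have hJ : Real.exp ((A + 1) * m) ≤ K := by
    have h := exp_integral_le_integral_exp (μ := μ) (hNi.const_mul (A + 1)) hKi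
    rw [integral_const_mul] at h
    exact h.trans hK
  have hK0 : 0 ≤ K := (integral_nonneg fun ω ↦ (Real.exp_pos _).le).trans hK
  -- pointwise bounds
  set x : Ω → ℝ := fun ω ↦ l * (Y ω - mY) with hx
  have habsx : ∀ ω, |x ω| ≤ |l| * b * (N ω + m) := fun ω ↦ by
    rw [hx]; dsimp only
    rw [abs_mul]
    have : |Y ω - mY| ≤ b * (N ω + m) := by
      calc |Y ω - mY| ≤ |Y ω| + |mY| := abs_sub _ _
        _ ≤ b * N ω + b * m := add_le_add (hdom ω) hmY_le
        _ = b * (N ω + m) := by ring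
    calc |l| * |Y ω - mY| ≤ |l| * (b * (N ω + m)) := mul_le_mul_of_nonneg_left this (abs_nonneg l)
      _ = |l| * b * (N ω + m) := by ring
  have hpt : ∀ ω, Real.exp (x ω) ≤ 1 + x ω + 2 * l ^ 2 * b ^ 2 * Real.exp ((A + 1) * (N ω + m)) := by
    intro ω
    have hNm0 : 0 ≤ N ω + m := add_nonneg (hN0 ω) hm0
    -- second-order bound `e^x − 1 − x ≤ x² e^{|x|}` (`x ≥ 0`: §1; `x < 0`: `sinh x ≤ x`)
    have h1 : Real.exp (x ω) - 1 - x ω ≤ x ω ^ 2 * Real.exp |x ω| := by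
      rcases le_or_gt 0 (x ω) with h0 | h0
      · rw [abs_of_nonneg h0]
        exact exp_sub_one_sub_le_sq_mul_exp h0
      · rw [abs_of_neg h0]
        have e1 := exp_sub_one_sub_le_sq_mul_exp (neg_nonneg.2 h0.le)
        have e2 : Real.sinh (x ω) ≤ x ω := Real.sinh_le_self_iff.2 h0.le
        rw [Real.sinh_eq] at e2
        nlinarith [e1, e2]
    have h2 : x ω ^ 2 * Real.exp |x ω| ≤
        (|l| * b) ^ 2 * ((N ω + m) ^ 2 * Real.exp (|l| * b * (N ω + m))) := by
      have e1 : x ω ^ 2 ≤ (|l| * b) ^ 2 * (N ω + m) ^ 2 := by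
        rw [← mul_pow, ← sq_abs (x ω)]
        exact pow_le_pow_left₀ (abs_nonneg _) (habsx ω) 2
      have e2 : Real.exp |x ω| ≤ Real.exp (|l| * b * (N ω + m)) := Real.exp_le_exp.2 (habsx ω)
      calc x ω ^ 2 * Real.exp |x ω| ≤ (|l| * b) ^ 2 * (N ω + m) ^ 2 * Real.exp (|l| * b * (N ω + m)) :=
            mul_le_mul e1 e2 (Real.exp_pos _).le (by positivity)
        _ = _ := by ring
    have h3 : (N ω + m) ^ 2 * Real.exp (|l| * b * (N ω + m)) ≤
        2 * Real.exp ((A + 1) * (N ω + m)) := by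
      refine (sq_mul_exp_le hNm0).trans ?_
      refine mul_le_mul_of_nonneg_left (Real.exp_le_exp.2 ?_) (by norm_num)
      exact mul_le_mul_of_nonneg_right (by linarith) hNm0
    have h4 : (|l| * b) ^ 2 = l ^ 2 * b ^ 2 := by rw [mul_pow, sq_abs]
    nlinarith [h2, h3, sq_nonneg (l * b), Real.exp_pos ((A + 1) * (N ω + m))]
  -- integrability of the majorant and of `e^x`
  have hmeas_x : Measurable x := (hYm.sub_const _).const_mul _
  have hmaj : Integrable (fun ω ↦ 1 + x ω + 2 * l ^ 2 * b ^ 2 * Real.exp ((A + 1) * (N ω + m))) μ := by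
    refine ((integrable_const _).add ((hYi.sub (integrable_const _)).const_mul l)).add ?_
    have : (fun ω ↦ 2 * l ^ 2 * b ^ 2 * Real.exp ((A + 1) * (N ω + m))) =
        fun ω ↦ (2 * l ^ 2 * b ^ 2 * Real.exp ((A + 1) * m)) * Real.exp ((A + 1) * N ω) := by
      funext ω; rw [mul_add, Real.exp_add]; ring
    rw [this]
    exact hKi.const_mul _
  have hexi : Integrable (fun ω ↦ Real.exp (x ω)) μ :=
    hmaj.mono' (Real.measurable_exp.comp hmeas_x).aestronglyMeasurable
      (Eventually.of_forall fun ω ↦ by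
        rw [Real.norm_eq_abs, abs_of_pos (Real.exp_pos _)]; exact hpt ω)
  refine ⟨hexi, ?_⟩
  -- integrate
  have hxi : Integrable x μ := (hYi.sub (integrable_const _)).const_mul l
  have hEx : ∫ ω, x ω ∂μ = 0 := by
    rw [hx]; dsimp only
    rw [integral_const_mul, integral_sub hYi (integrable_const _), integral_const, probReal_univ,
      one_smul, ← hmY, sub_self, mul_zero]
  set C : ℝ := 2 * l ^ 2 * b ^ 2 * Real.exp ((A + 1) * m) with hC
  have hCi : Integrable (fun ω ↦ C * Real.exp ((A + 1) * N ω)) μ := hKi.const_mul _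
  have h1i : Integrable (fun ω ↦ (1 : ℝ) + x ω) μ := (integrable_const _).add hxi
  have hsplit : ∫ ω, (1 + x ω + 2 * l ^ 2 * b ^ 2 * Real.exp ((A + 1) * (N ω + m))) ∂μ =
      (∫ ω, (1 + x ω) ∂μ) + ∫ ω, C * Real.exp ((A + 1) * N ω) ∂μ := by
    calc ∫ ω, (1 + x ω + 2 * l ^ 2 * b ^ 2 * Real.exp ((A + 1) * (N ω + m))) ∂μ
        = ∫ ω, ((1 + x ω) + C * Real.exp ((A + 1) * N ω)) ∂μ := by
          refine integral_congr_ae (Eventually.of_forall fun ω ↦ ?_)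
          dsimp only
          rw [hC, mul_add, Real.exp_add]; ring
      _ = _ := integral_add h1i hCi
  calc ∫ ω, Real.exp (x ω) ∂μ
      ≤ ∫ ω, (1 + x ω + 2 * l ^ 2 * b ^ 2 * Real.exp ((A + 1) * (N ω + m))) ∂μ :=
        integral_mono hexi hmaj hpt
    _ = 1 + C * ∫ ω, Real.exp ((A + 1) * N ω) ∂μ := by
        rw [hsplit, integral_add (integrable_const _) hxi, integral_const, probReal_univ, one_smul, hEx,
          add_zero, integral_const_mul]
    _ ≤ 1 + 2 * l ^ 2 * b ^ 2 * K * K := by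
        rw [hC]
        have h1 : Real.exp ((A + 1) * m) * ∫ ω, Real.exp ((A + 1) * N ω) ∂μ ≤ K * K :=
          mul_le_mul hJ hK (integral_nonneg fun ω ↦ (Real.exp_pos _).le) hK0
        nlinarith [h1, sq_nonneg (l * b)]
    _ ≤ Real.exp (2 * l ^ 2 * b ^ 2 * K ^ 2) := by
        have := Real.add_one_le_exp (2 * l ^ 2 * b ^ 2 * K ^ 2)
        nlinarith

/-! ## §3 Generalised Hölder for exponentials -/

omit [MeasurableSpace Ω] in
/-- Pointwise: `Π_i (e^{X_i/w_i})^{w_i} = e^{Σ_i X_i}` for non-zero weights. -/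
theorem prod_exp_div_rpow_eq {ι : Type*} (s : Finset ι) (X : ι → Ω → ℝ) (w : ι → ℝ)
    (hw : ∀ i ∈ s, w i ≠ 0) (ω : Ω) :
    ∏ i ∈ s, Real.exp (X i ω / w i) ^ w i = Real.exp (∑ i ∈ s, X i ω) := by
  rw [Real.exp_sum]
  refine Finset.prod_congr rfl fun i hi ↦ ?_
  rw [← Real.exp_mul, div_mul_cancel₀ _ (hw i hi)]

/-- **Generalised Hölder for exponentials, total weight one.**  For positive weights `w_i` with
`Σ_{i ∈ s} w_i = 1` and integrable `e^{X_i/w_i}`: `e^{Σ_i X_i}` is integrable and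
`E e^{Σ_{i ∈ s} X_i} ≤ Π_{i ∈ s} (E e^{X_i/w_i})^{w_i}` (Mathlib's `ENNReal.lintegral_prod_norm_pow_le`
applied to `f_i = e^{X_i/w_i}`, `p_i = w_i`). -/
theorem integral_exp_sum_le_of_sum_eq_one {ι : Type*} (s : Finset ι) {X : ι → Ω → ℝ} {w : ι → ℝ}
    (hw0 : ∀ i ∈ s, 0 < w i) (hw1 : ∑ i ∈ s, w i = 1) (hXm : ∀ i ∈ s, Measurable (X i))
    (hint : ∀ i ∈ s, Integrable (fun ω ↦ Real.exp (X i ω / w i)) μ) :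
    Integrable (fun ω ↦ Real.exp (∑ i ∈ s, X i ω)) μ ∧
      ∫ ω, Real.exp (∑ i ∈ s, X i ω) ∂μ ≤ ∏ i ∈ s, (∫ ω, Real.exp (X i ω / w i) ∂μ) ^ w i := by
  set f : ι → Ω → ℝ≥0∞ := fun i ω ↦ ENNReal.ofReal (Real.exp (X i ω / w i)) with hf
  have hfm : ∀ i ∈ s, AEMeasurable (f i) μ := fun i hi ↦
    (Real.measurable_exp.comp ((hXm i hi).div_const _)).ennreal_ofReal.aemeasurable
  have hH := ENNReal.lintegral_prod_norm_pow_le s hfm hw1 fun i hi ↦ (hw0 i hi).le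
  -- identify the integrand
  have hprod : ∀ ω, ∏ i ∈ s, f i ω ^ w i = ENNReal.ofReal (Real.exp (∑ i ∈ s, X i ω)) := by
    intro ω
    rw [← prod_exp_div_rpow_eq s X w (fun i hi ↦ (hw0 i hi).ne') ω,
      ENNReal.ofReal_prod_of_nonneg fun i _ ↦ Real.rpow_nonneg (Real.exp_pos _).le _]
    refine Finset.prod_congr rfl fun i hi ↦ ?_
    rw [hf]; dsimp only
    rw [ENNReal.ofReal_rpow_of_nonneg (Real.exp_pos _).le (hw0 i hi).le]
  -- identify the factors
  have hfac : ∀ i ∈ s, ∫⁻ ω, f i ω ∂μ = ENNReal.ofReal (∫ ω, Real.exp (X i ω / w i) ∂μ) :=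
    fun i hi ↦ (ofReal_integral_eq_lintegral_ofReal (hint i hi)
      (Eventually.of_forall fun ω ↦ (Real.exp_pos _).le)).symm
  simp_rw [hprod] at hH
  have hR : ∏ i ∈ s, (∫⁻ ω, f i ω ∂μ) ^ w i =
      ENNReal.ofReal (∏ i ∈ s, (∫ ω, Real.exp (X i ω / w i) ∂μ) ^ w i) := by
    rw [ENNReal.ofReal_prod_of_nonneg fun i _ ↦
      Real.rpow_nonneg (integral_nonneg fun ω ↦ (Real.exp_pos _).le) _]
    refine Finset.prod_congr rfl fun i hi ↦ ?_
    rw [hfac i hi, ENNReal.ofReal_rpow_of_nonneg (integral_nonneg fun ω ↦ (Real.exp_pos _).le)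
      (hw0 i hi).le]
  rw [hR] at hH
  have hmeas : Measurable fun ω ↦ Real.exp (∑ i ∈ s, X i ω) :=
    Real.measurable_exp.comp (Finset.measurable_sum s fun i hi ↦ hXm i hi)
  have hne : ∫⁻ ω, ENNReal.ofReal (Real.exp (∑ i ∈ s, X i ω)) ∂μ ≠ ⊤ :=
    ne_top_of_le_ne_top ENNReal.ofReal_ne_top hH
  have hI : Integrable (fun ω ↦ Real.exp (∑ i ∈ s, X i ω)) μ :=
    (lintegral_ofReal_ne_top_iff_integrable hmeas.aestronglyMeasurable
      (Eventually.of_forall fun ω ↦ (Real.exp_pos _).le)).1 hne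
  refine ⟨hI, ?_⟩
  have h := ENNReal.toReal_mono ENNReal.ofReal_ne_top hH
  rwa [← ofReal_integral_eq_lintegral_ofReal hI (Eventually.of_forall fun ω ↦ (Real.exp_pos _).le),
    ENNReal.toReal_ofReal (integral_nonneg fun ω ↦ (Real.exp_pos _).le),
    ENNReal.toReal_ofReal (Finset.prod_nonneg fun i _ ↦
      Real.rpow_nonneg (integral_nonneg fun ω ↦ (Real.exp_pos _).le) _)] at h

/-- **Generalised Hölder for exponentials on a probability space, total weight at most one**:
positive weights with `Σ_{i ∈ s} w_i ≤ 1` (pad with the constant statistic `0`, weight `1 − Σ w`). -/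
theorem integral_exp_sum_le [IsProbabilityMeasure μ] {ι : Type*} (s : Finset ι) {X : ι → Ω → ℝ}
    {w : ι → ℝ} (hw0 : ∀ i ∈ s, 0 < w i) (hw1 : ∑ i ∈ s, w i ≤ 1) (hXm : ∀ i ∈ s, Measurable (X i))
    (hint : ∀ i ∈ s, Integrable (fun ω ↦ Real.exp (X i ω / w i)) μ) :
    Integrable (fun ω ↦ Real.exp (∑ i ∈ s, X i ω)) μ ∧
      ∫ ω, Real.exp (∑ i ∈ s, X i ω) ∂μ ≤ ∏ i ∈ s, (∫ ω, Real.exp (X i ω / w i) ∂μ) ^ w i := by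
  rcases hw1.lt_or_eq with hlt | heq
  · -- pad with `none ↦ 0`, weight `1 - Σ w`
    set X' : Option ι → Ω → ℝ := fun o ↦ Option.elim o (fun _ ↦ 0) X with hX'
    set w' : Option ι → ℝ := fun o ↦ Option.elim o (1 - ∑ i ∈ s, w i) w with hw'
    have h0 : ∀ o ∈ Finset.insertNone s, 0 < w' o := by
      rintro (_ | i) ho
      · simpa [hw'] using hlt
      · exact hw0 i (Finset.some_mem_insertNone.1 ho)
    have h1 : ∑ o ∈ Finset.insertNone s, w' o = 1 := by
      rw [Finset.sum_insertNone]; simp [hw']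
    have hm : ∀ o ∈ Finset.insertNone s, Measurable (X' o) := by
      rintro (_ | i) ho
      · exact measurable_const
      · exact hXm i (Finset.some_mem_insertNone.1 ho)
    have hi : ∀ o ∈ Finset.insertNone s, Integrable (fun ω ↦ Real.exp (X' o ω / w' o)) μ := by
      rintro (_ | i) ho
      · simp only [hX', Option.elim, zero_div, Real.exp_zero]; exact integrable_const _
      · exact hint i (Finset.some_mem_insertNone.1 ho)
    obtain ⟨hI, hle⟩ := integral_exp_sum_le_of_sum_eq_one (μ := μ) (Finset.insertNone s) h0 h1 hm hi
    simp only [Finset.sum_insertNone, Finset.prod_insertNone, hX', hw', Option.elim, zero_add,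
      zero_div, Real.exp_zero, integral_const, probReal_univ, smul_eq_mul, mul_one, Real.one_rpow,
      one_mul] at hI hle
    exact ⟨hI, hle⟩
  · exact integral_exp_sum_le_of_sum_eq_one s hw0 heq hXm hint

end UVExpMoments

/-! ## The two steps on the lattice ensembles (registered anchors) -/

/-- **One cell of the multi-scale bound behind [A] `uvExpMoments_latticeEnsembles`, on both lattice
ensembles** (registered helper, line `positive-cone-weight-doubling`): a cell statistic `Y` dominated
by a nonnegative loop count, `|Y| ≤ b N`, with `E_δ e^{(A+1)N} ≤ K`, has the CENTRED exponential
moment `E_δ e^{λ(Y − E_δ Y)} ≤ exp(2 λ² b² K²)` for every `|λ| b ≤ A` (quadratic in `λ`: no linear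
term survives the centring). -/
theorem expMoment_centred_le_latticeEnsembles : ∀ E ∈ latticeEnsembles, ∀ (Y N : E.Ω → ℝ)
    (b A K l : ℝ), Measurable Y → Measurable N → 0 ≤ b → (∀ ω, |Y ω| ≤ b * N ω) → (∀ ω, 0 ≤ N ω) →
    Integrable (fun ω ↦ Real.exp ((A + 1) * N ω)) E.P → ∫ ω, Real.exp ((A + 1) * N ω) ∂E.P ≤ K →
    |l| * b ≤ A →
    Integrable (fun ω ↦ Real.exp (l * (Y ω - ∫ ω', Y ω' ∂E.P))) E.P ∧
      ∫ ω, Real.exp (l * (Y ω - ∫ ω', Y ω' ∂E.P)) ∂E.P ≤ Real.exp (2 * l ^ 2 * b ^ 2 * K ^ 2) := by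
  intro E hE Y N b A K l hYm hNm hb hdom hN0 hKi hK hl
  haveI := isProbabilityMeasure_of_mem hE
  exact UVExpMoments.integral_exp_centred_le hYm hNm hb hdom hN0 hKi hK hl

/-- **Generalised Hölder for exponential moments on both lattice ensembles** (registered helper,
line `positive-cone-weight-doubling`): for finitely many statistics `X_i` and positive weights `w_i`
of total mass `≤ 1`, `E_δ e^{Σ_i X_i} ≤ Π_i (E_δ e^{X_i/w_i})^{w_i}` (integrability included) — the
assembly tool across dependent pieces: the `L` chessboard classes of one scale (equal weights `1/L`),
the dyadic scales (`w_k = 2^{-k-1}`), and the boundary pieces of the UV statistic. -/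
theorem expMoment_sum_le_prod_latticeEnsembles : ∀ E ∈ latticeEnsembles, ∀ (ι : Type) (s : Finset ι)
    (X : ι → E.Ω → ℝ) (w : ι → ℝ), (∀ i ∈ s, 0 < w i) → ∑ i ∈ s, w i ≤ 1 →
    (∀ i ∈ s, Measurable (X i)) → (∀ i ∈ s, Integrable (fun ω ↦ Real.exp (X i ω / w i)) E.P) →
    Integrable (fun ω ↦ Real.exp (∑ i ∈ s, X i ω)) E.P ∧
      ∫ ω, Real.exp (∑ i ∈ s, X i ω) ∂E.P ≤ ∏ i ∈ s, (∫ ω, Real.exp (X i ω / w i) ∂E.P) ^ w i := by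
  intro E hE ι s X w hw0 hw1 hXm hint
  haveI := isProbabilityMeasure_of_mem hE
  exact UVExpMoments.integral_exp_sum_le s hw0 hw1 hXm hint

end Summit.CriticalPhenomena.CardyFormulaZ2.Cruxes.NestingRigidity.PositiveConeWeightDoubling

end
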